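import Summits.Ventures.LatticeQCDFlow.Exactness.ReversiblePositive
import Summits.Ventures.LatticeQCDFlow.Exactness.ReversibleThinning
import Summits.Ventures.LatticeQCDFlow.Exactness.ReversibleComparison
import HarnessLib

/-!
# Thinning is PINNED for positive samplers — `V(τ^{(V)} − ½) ≤ τ − ½ ≤ V(τ^{(V)} + ½) − ½` — and the PER-SWEEP comparison theorem `τ'_sweep + ½ ≤ c(τ_sweep + ½) + 1 − 1/V`

HONEST FRAMING: exact (Metropolis-corrected) sampling algorithms for lattice gauge theory;
figures of merit are autocorrelation/cost numbers at stated couplings and volumes; no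
continuum-physics claim.  (SCALAR calibration rung S0-A: not a gauge result.)

Venture `LatticeQCDFlow` (cell pub-lqcd), topic `Exactness`; FANOUT row 2 (`s0-phi4`; gen-18's
leftover (α⁷) "per-sweep UPPER comparison for the local arm").  NEW WORK of the cell over
`Exactness/ReversiblePositive.lean` ((pos) ⇒ nonincreasing nonnegative autocovariances),
`Exactness/ReversibleThinning.lean` (`τ + ½ ≤ V(τ^{(V)} + ½)`, every reversible sampler) and
`Exactness/ReversibleComparison.lean` (`𝓔 ≤ c𝓔' ⇒ τ' + ½ ≤ c(τ + ½)`), in the `RevOp` format.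
Nothing is cited as a fact.  Printed counterparts NAMED ONLY: Geyer 1992 (Statist. Sci. 7, Thm 3.3)
and MacEachern–Berliner 1994 (subsampling a reversible chain cannot improve the variance at fixed
effort); the upper direction for positive chains is folklore via the spectral theorem
(`Σ_k λ^{Vk} ≤ 1 + (1/V) Σ_{j≥1} λ^j` for `λ ∈ [0, 1]`); no printed per-sweep comparison
statement with the additive `1 − 1/V` was found (presearch: corpus hybrid / vsearch "thinning
positive Markov chain autocorrelation bound", galaxy "subsampling|thinning the chain" — none).

## Setting

`K` a reversible exact sampler on the admissible class `A` (weight `w ≥ 0`); `a(k) = ∫ g (Kᵏ g) w`,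
`ρ(k) = a(k)/a(0)`; the chain observed every `V ≥ 1` steps has autocorrelations `k ↦ ρ(Vk)` and
integrated autocorrelation time `τ^{(V)}` ("per sweep" when `V` = number of proposals per sweep).

## What is proved (namespace `RevOp`)

* §1 (real sequences) `mul_sum_thinned_le_of_succ_le`, `summable_thinned_of_succ_le`,
  `mul_tsum_thinned_le_of_succ_le` — for a nonnegative nonincreasing sequence,
  `V · Σ_{k≥1} a(Vk) ≤ Σ_{j≥1} a(j)` and thinned summability follows from full summability;
* §2 (pos): **`summable_thinned_of_pos`** and **`mul_thinned_tauInt_sub_half_le_of_pos`** —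
  `V · (τ^{(V)} − ½) ≤ τ − ½`: for a POSITIVE sampler, observing every `V`-th state divides
  `τ − ½` by AT LEAST `V` (while `ReversibleThinning` says it divides `τ + ½` by AT MOST `V`, for
  every reversible sampler): thinning is pinned, `(τ + ½)/V − ½ ≤ τ^{(V)} ≤ ½ + (τ − ½)/V`,
  a window of width `1 − 1/V < 1` for every observable — **`thinned_tauInt_pinned_of_pos`**;
* §3 **`thinned_tauInt_le_of_dirichlet_le_mul_of_pos`** — THE PER-SWEEP COMPARISON THEOREM: `K` any
  reversible exact sampler, `K'` a POSITIVE one, same target and class, Dirichlet domination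
  `𝓔(v) ≤ c 𝓔'(v)` on `A` (`c > 0`), all series summable: for every `g ∈ A` and `V ≥ 1`,
  **`τ'^{(V)} + ½ ≤ c (τ^{(V)} + ½) + (1 − 1/V)`**; `c = 1`: **`thinned_tauInt_le_of_dirichlet_le_of_pos`**,
  `τ'^{(V)} ≤ τ^{(V)} + 1 − 1/V` — per sweep, the sampler that moves more is slower by less than one
  sweep, for every observable (gen-18 had the per-proposal order only; Dirichlet domination is not
  inherited by `K^V`, positivity of the dominating chain replaces it).

Lattice instance (local arm, Gaussian step laws of two widths; flow arm) in the lattice files of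
this generation.  NOT CLAIMED: the per-sweep comparison when the faster chain is not positive
(false in general: a period-two component is invisible at even `V`); Geyer's sharper variance
constant; any number for any run.
-/

namespace Summit.Ventures.LatticeQCDFlow.Exactness

open Real MeasureTheory Filter Finset Topology
open Summit.Ventures.LatticeQCDFlow.Scoring

namespace RevOp

variable {X : Type*} [MeasurableSpace X] {μ : Measure X} {w : X → ℝ} {A : (X → ℝ) → Prop}
  {K K' : (X → ℝ) → (X → ℝ)}

/-! ## §1 Real sequences: thinning a nonnegative nonincreasing sequence -/

/-- Block comparison: `V · Σ_{k<N} a(V(k+1)) ≤ Σ_{j < VN} a(j+1)` for a nonincreasing sequence. -/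
theorem mul_sum_thinned_le_of_succ_le {a : ℕ → ℝ} (hmono : ∀ k, a (k + 1) ≤ a k) {V : ℕ}
    (hV : 1 ≤ V) :
    ∀ N : ℕ, (V : ℝ) * ∑ k ∈ Finset.range N, a (V * (k + 1))
      ≤ ∑ j ∈ Finset.range (V * N), a (j + 1)
  | 0 => by simp
  | N + 1 => by
    have ih := mul_sum_thinned_le_of_succ_le hmono hV N
    have hanti : Antitone a := antitone_nat_of_succ_le hmono
    rw [Finset.sum_range_succ, mul_add, show V * (N + 1) = V * N + V by ring,
      Finset.sum_range_add]
    have hblock : (V : ℝ) * a (V * N + V) ≤ ∑ i ∈ Finset.range V, a (V * N + i + 1) := by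
      have h : ∑ _i ∈ Finset.range V, a (V * N + V) ≤ ∑ i ∈ Finset.range V, a (V * N + i + 1) :=
        Finset.sum_le_sum fun i hi => hanti (by
          have := Finset.mem_range.1 hi
          omega)
      rwa [Finset.sum_const, Finset.card_range, nsmul_eq_mul] at h
    have _ := hV
    linarith

/-- Full summability gives thinned summability (nonnegative nonincreasing sequence, `V ≥ 1`). -/
theorem summable_thinned_of_succ_le {a : ℕ → ℝ} (h0 : ∀ k, 0 ≤ a k) (hmono : ∀ k, a (k + 1) ≤ a k)
    {V : ℕ} (hV : 1 ≤ V) (hs : Summable fun j => a (j + 1)) :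
    Summable fun k => a (V * (k + 1)) := by
  have hanti : Antitone a := antitone_nat_of_succ_le hmono
  refine Summable.of_nonneg_of_le (fun k => h0 _) (fun k => hanti ?_) hs
  nlinarith

/-- **`V · Σ_{k≥1} a(Vk) ≤ Σ_{j≥1} a(j)`** for a nonnegative nonincreasing summable sequence. -/
theorem mul_tsum_thinned_le_of_succ_le {a : ℕ → ℝ} (h0 : ∀ k, 0 ≤ a k)
    (hmono : ∀ k, a (k + 1) ≤ a k) {V : ℕ} (hV : 1 ≤ V) (hs : Summable fun j => a (j + 1)) :
    (V : ℝ) * ∑' k, a (V * (k + 1)) ≤ ∑' j, a (j + 1) := by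
  have hsV := summable_thinned_of_succ_le h0 hmono hV hs
  rw [← tsum_mul_left]
  refine (hsV.mul_left (V : ℝ)).tsum_le_of_sum_range_le fun N => ?_
  rw [← Finset.mul_sum]
  exact (mul_sum_thinned_le_of_succ_le hmono hV N).trans
    (hs.sum_le_tsum (Finset.range (V * N)) fun j _ => h0 _)

/-! ## §2 Positive samplers: thinning is pinned -/

/-- (pos): the thinned series of every observable is summable as soon as the full one is. -/
theorem summable_thinned_of_pos (hw0 : ∀ x, 0 ≤ w x)
    (hAi : ∀ ⦃f h : X → ℝ⦄, A f → A h → Integrable (fun x => f x * h x * w x) μ)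
    (hAc : ∀ ⦃f h : X → ℝ⦄ (c : ℝ), A f → A h → A (fun x => f x + c * h x))
    (hAK : ∀ ⦃f : X → ℝ⦄, A f → A (K f))
    (hlin : ∀ ⦃f h : X → ℝ⦄ (c : ℝ), A f → A h →
      ∀ x, K (fun s => f s + c * h s) x = K f x + c * K h x)
    (hsymm : ∀ ⦃f h : X → ℝ⦄, A f → A h →
      ∫ x, K f x * h x * w x ∂μ = ∫ x, f x * K h x * w x ∂μ)
    (hcontr : ∀ ⦃f : X → ℝ⦄, A f → ∫ x, K f x ^ 2 * w x ∂μ ≤ ∫ x, f x ^ 2 * w x ∂μ)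
    (hpos : ∀ ⦃f : X → ℝ⦄, A f → 0 ≤ ∫ x, f x * K f x * w x ∂μ)
    {g : X → ℝ} (hg : A g) {V : ℕ} (hV : 1 ≤ V)
    (hs : Summable fun n => (∫ x, g x * (K^[n + 1] g) x * w x ∂μ) / ∫ x, g x ^ 2 * w x ∂μ) :
    Summable fun n => (∫ x, g x * (K^[V * (n + 1)] g) x * w x ∂μ) / ∫ x, g x ^ 2 * w x ∂μ := by
  have hP0 : 0 ≤ ∫ x, g x ^ 2 * w x ∂μ := integral_nonneg fun x => mul_nonneg (sq_nonneg _) (hw0 x)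
  have h := summable_thinned_of_succ_le (a := fun k => ∫ x, g x * (K^[k] g) x * w x ∂μ)
    (autocov_nonneg_of_pos hw0 hAK hsymm hpos hg)
    (autocov_succ_le_of_pos hw0 hAi hAc hAK hlin hsymm hcontr hpos hg) hV
    ((hs.mul_right (∫ x, g x ^ 2 * w x ∂μ)).congr fun n => by
      rcases eq_or_lt_of_le hP0 with hz | hp
      · have h0 : ∫ x, g x * (K^[n + 1] g) x * w x ∂μ = 0 := by
          have h := abs_autocov_le hw0 hAi hAK hcontr hg (n + 1)
          rw [← hz] at h
          exact abs_nonpos_iff.1 h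
        rw [h0]
        ring
      · field_simp)
  exact (h.div_const (∫ x, g x ^ 2 * w x ∂μ))

/-- **THINNING DIVIDES `τ − ½` BY AT LEAST `V` (positive samplers).**  For every `g ∈ A` with a
summable series and every `V ≥ 1`:  `V · (τ^{(V)} − ½) ≤ τ − ½`. -/
theorem mul_thinned_tauInt_sub_half_le_of_pos (hw0 : ∀ x, 0 ≤ w x)
    (hAi : ∀ ⦃f h : X → ℝ⦄, A f → A h → Integrable (fun x => f x * h x * w x) μ)
    (hAc : ∀ ⦃f h : X → ℝ⦄ (c : ℝ), A f → A h → A (fun x => f x + c * h x))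
    (hAK : ∀ ⦃f : X → ℝ⦄, A f → A (K f))
    (hlin : ∀ ⦃f h : X → ℝ⦄ (c : ℝ), A f → A h →
      ∀ x, K (fun s => f s + c * h s) x = K f x + c * K h x)
    (hsymm : ∀ ⦃f h : X → ℝ⦄, A f → A h →
      ∫ x, K f x * h x * w x ∂μ = ∫ x, f x * K h x * w x ∂μ)
    (hcontr : ∀ ⦃f : X → ℝ⦄, A f → ∫ x, K f x ^ 2 * w x ∂μ ≤ ∫ x, f x ^ 2 * w x ∂μ)
    (hpos : ∀ ⦃f : X → ℝ⦄, A f → 0 ≤ ∫ x, f x * K f x * w x ∂μ)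
    {g : X → ℝ} (hg : A g) {V : ℕ} (hV : 1 ≤ V)
    (hs : Summable fun n => (∫ x, g x * (K^[n + 1] g) x * w x ∂μ) / ∫ x, g x ^ 2 * w x ∂μ) :
    (V : ℝ) * (tauInt (fun n => (∫ x, g x * (K^[V * n] g) x * w x ∂μ) / ∫ x, g x ^ 2 * w x ∂μ)
        - 1 / 2)
      ≤ tauInt (fun n => (∫ x, g x * (K^[n] g) x * w x ∂μ) / ∫ x, g x ^ 2 * w x ∂μ) - 1 / 2 := by
  have hP0 : 0 ≤ ∫ x, g x ^ 2 * w x ∂μ := integral_nonneg fun x => mul_nonneg (sq_nonneg _) (hw0 x)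
  set P := ∫ x, g x ^ 2 * w x ∂μ with hP
  have h0 : ∀ k, 0 ≤ (∫ x, g x * (K^[k] g) x * w x ∂μ) / P := fun k =>
    div_nonneg (autocov_nonneg_of_pos hw0 hAK hsymm hpos hg k) hP0
  have hmono : ∀ k, (∫ x, g x * (K^[k + 1] g) x * w x ∂μ) / P
      ≤ (∫ x, g x * (K^[k] g) x * w x ∂μ) / P := fun k =>
    div_le_div_of_nonneg_right (autocov_succ_le_of_pos hw0 hAi hAc hAK hlin hsymm hcontr hpos hg k) hP0
  have h := mul_tsum_thinned_le_of_succ_le (a := fun k => (∫ x, g x * (K^[k] g) x * w x ∂μ) / P)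
    h0 hmono hV hs
  unfold tauInt
  have e : ∀ n : ℕ, V * (n + 1) = V * n + V := fun n => by ring
  simp only [Nat.mul_succ] at h ⊢
  linarith

/-- **THINNING IS PINNED for positive samplers** (with `Exactness/ReversibleThinning.lean`):
`(τ + ½)/V − ½ ≤ τ^{(V)} ≤ ½ + (τ − ½)/V` — a window of width `1 − 1/V` for every observable. -/
theorem thinned_tauInt_pinned_of_pos (hw0 : ∀ x, 0 ≤ w x)
    (hAi : ∀ ⦃f h : X → ℝ⦄, A f → A h → Integrable (fun x => f x * h x * w x) μ)
    (hAc : ∀ ⦃f h : X → ℝ⦄ (c : ℝ), A f → A h → A (fun x => f x + c * h x))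
    (hAK : ∀ ⦃f : X → ℝ⦄, A f → A (K f))
    (hlin : ∀ ⦃f h : X → ℝ⦄ (c : ℝ), A f → A h →
      ∀ x, K (fun s => f s + c * h s) x = K f x + c * K h x)
    (hsymm : ∀ ⦃f h : X → ℝ⦄, A f → A h →
      ∫ x, K f x * h x * w x ∂μ = ∫ x, f x * K h x * w x ∂μ)
    (hcontr : ∀ ⦃f : X → ℝ⦄, A f → ∫ x, K f x ^ 2 * w x ∂μ ≤ ∫ x, f x ^ 2 * w x ∂μ)
    (hpos : ∀ ⦃f : X → ℝ⦄, A f → 0 ≤ ∫ x, f x * K f x * w x ∂μ)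
    {g : X → ℝ} (hg : A g) (hP : 0 < ∫ x, g x ^ 2 * w x ∂μ) {V : ℕ} (hV : 1 ≤ V)
    (hs : Summable fun n => (∫ x, g x * (K^[n + 1] g) x * w x ∂μ) / ∫ x, g x ^ 2 * w x ∂μ) :
    (tauInt (fun n => (∫ x, g x * (K^[n] g) x * w x ∂μ) / ∫ x, g x ^ 2 * w x ∂μ) + 1 / 2) / V
        - 1 / 2
      ≤ tauInt (fun n => (∫ x, g x * (K^[V * n] g) x * w x ∂μ) / ∫ x, g x ^ 2 * w x ∂μ) ∧
    tauInt (fun n => (∫ x, g x * (K^[V * n] g) x * w x ∂μ) / ∫ x, g x ^ 2 * w x ∂μ)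
      ≤ 1 / 2 + (tauInt (fun n => (∫ x, g x * (K^[n] g) x * w x ∂μ) / ∫ x, g x ^ 2 * w x ∂μ)
        - 1 / 2) / V := by
  have hV' : (0 : ℝ) < (V : ℝ) := by exact_mod_cast hV
  have hsV := summable_thinned_of_pos hw0 hAi hAc hAK hlin hsymm hcontr hpos hg hV hs
  have hlow := tauInt_add_half_le_mul_thinned hw0 hAi hAc hAK hlin hsymm hcontr hg hP hV hs hsV
  have hup := mul_thinned_tauInt_sub_half_le_of_pos hw0 hAi hAc hAK hlin hsymm hcontr hpos hg hV hs
  constructor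
  · rw [div_sub' (ne_of_gt hV'), div_le_iff₀ hV']
    linarith
  · rw [← sub_le_iff_le_add', le_div_iff₀ hV']
    linarith

/-! ## §3 The per-sweep comparison theorem -/

/-- **THE PER-SWEEP COMPARISON THEOREM.**  `K` a reversible exact sampler, `K'` a POSITIVE
reversible exact sampler of the same target on the same admissible class, with Dirichlet-form
domination `𝓔(v) ≤ c · 𝓔'(v)` on `A` (`c > 0`).  For every `g ∈ A` (`∫ g² w > 0`) whose series under
`K` (full and `V`-thinned) and under `K'` are summable, and every `V ≥ 1`:
`τ'^{(V)} + ½ ≤ c · (τ^{(V)} + ½) + (1 − 1/V)`. -/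
theorem thinned_tauInt_le_of_dirichlet_le_mul_of_pos (hw0 : ∀ x, 0 ≤ w x)
    (hAi : ∀ ⦃f h : X → ℝ⦄, A f → A h → Integrable (fun x => f x * h x * w x) μ)
    (hAc : ∀ ⦃f h : X → ℝ⦄ (c : ℝ), A f → A h → A (fun x => f x + c * h x))
    (hAK : ∀ ⦃f : X → ℝ⦄, A f → A (K f))
    (hlin : ∀ ⦃f h : X → ℝ⦄ (c : ℝ), A f → A h →
      ∀ x, K (fun s => f s + c * h s) x = K f x + c * K h x)
    (hsymm : ∀ ⦃f h : X → ℝ⦄, A f → A h →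
      ∫ x, K f x * h x * w x ∂μ = ∫ x, f x * K h x * w x ∂μ)
    (hcontr : ∀ ⦃f : X → ℝ⦄, A f → ∫ x, K f x ^ 2 * w x ∂μ ≤ ∫ x, f x ^ 2 * w x ∂μ)
    (hAK' : ∀ ⦃f : X → ℝ⦄, A f → A (K' f))
    (hlin' : ∀ ⦃f h : X → ℝ⦄ (c : ℝ), A f → A h →
      ∀ x, K' (fun s => f s + c * h s) x = K' f x + c * K' h x)
    (hsymm' : ∀ ⦃f h : X → ℝ⦄, A f → A h →
      ∫ x, K' f x * h x * w x ∂μ = ∫ x, f x * K' h x * w x ∂μ)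
    (hcontr' : ∀ ⦃f : X → ℝ⦄, A f → ∫ x, K' f x ^ 2 * w x ∂μ ≤ ∫ x, f x ^ 2 * w x ∂μ)
    (hpos' : ∀ ⦃f : X → ℝ⦄, A f → 0 ≤ ∫ x, f x * K' f x * w x ∂μ)
    {c : ℝ} (hc : 0 < c)
    (hdom : ∀ ⦃v : X → ℝ⦄, A v →
      (∫ x, v x ^ 2 * w x ∂μ) - ∫ x, v x * K v x * w x ∂μ
        ≤ c * ((∫ x, v x ^ 2 * w x ∂μ) - ∫ x, v x * K' v x * w x ∂μ))
    {g : X → ℝ} (hg : A g) (hP : 0 < ∫ x, g x ^ 2 * w x ∂μ) {V : ℕ} (hV : 1 ≤ V)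
    (hs : Summable fun n => (∫ x, g x * (K^[n + 1] g) x * w x ∂μ) / ∫ x, g x ^ 2 * w x ∂μ)
    (hsV : Summable fun n => (∫ x, g x * (K^[V * (n + 1)] g) x * w x ∂μ) / ∫ x, g x ^ 2 * w x ∂μ)
    (hs' : Summable fun n => (∫ x, g x * (K'^[n + 1] g) x * w x ∂μ) / ∫ x, g x ^ 2 * w x ∂μ) :
    tauInt (fun n => (∫ x, g x * (K'^[V * n] g) x * w x ∂μ) / ∫ x, g x ^ 2 * w x ∂μ) + 1 / 2
      ≤ c * (tauInt (fun n => (∫ x, g x * (K^[V * n] g) x * w x ∂μ) / ∫ x, g x ^ 2 * w x ∂μ)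
          + 1 / 2) + (1 - 1 / V) := by
  have hV' : (0 : ℝ) < (V : ℝ) := by exact_mod_cast hV
  have h1V : (1 : ℝ) ≤ (V : ℝ) := by exact_mod_cast hV
  -- (i) per proposal: `τ' + ½ ≤ c (τ + ½)`
  have hcmp := tauInt_add_half_le_of_dirichlet_le_mul hw0 hAi hAc hAK hlin hsymm hcontr hAK' hlin'
    hsymm' hc hdom hg hP hs hs'
  -- (ii) thinning floor for `K`: `τ + ½ ≤ V (τ^{(V)} + ½)`
  have hlow := tauInt_add_half_le_mul_thinned hw0 hAi hAc hAK hlin hsymm hcontr hg hP hV hs hsV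
  -- (iii) thinning ceiling for the positive `K'`: `V (τ'^{(V)} − ½) ≤ τ' − ½`
  have hup := mul_thinned_tauInt_sub_half_le_of_pos hw0 hAi hAc hAK' hlin' hsymm' hcontr' hpos' hg
    hV hs'
  set T := tauInt (fun n => (∫ x, g x * (K^[n] g) x * w x ∂μ) / ∫ x, g x ^ 2 * w x ∂μ)
  set T' := tauInt (fun n => (∫ x, g x * (K'^[n] g) x * w x ∂μ) / ∫ x, g x ^ 2 * w x ∂μ)
  set TV := tauInt (fun n => (∫ x, g x * (K^[V * n] g) x * w x ∂μ) / ∫ x, g x ^ 2 * w x ∂μ)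
  set TV' := tauInt (fun n => (∫ x, g x * (K'^[V * n] g) x * w x ∂μ) / ∫ x, g x ^ 2 * w x ∂μ)
  -- `V (TV' − ½) ≤ T' − ½ ≤ c (T + ½) − 1 ≤ c V (TV + ½) − 1`; divide by `V`
  have h3 : (V : ℝ) * (TV' - 1 / 2) ≤ c * (V : ℝ) * (TV + 1 / 2) - 1 := by
    nlinarith [hup, hcmp, hlow, hc.le]
  have h4 : TV' - 1 / 2 ≤ c * (TV + 1 / 2) - 1 / V := by
    rw [show c * (TV + 1 / 2) - 1 / V = (c * (V : ℝ) * (TV + 1 / 2) - 1) / V by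
      field_simp]
    rw [le_div_iff₀ hV']
    linarith
  linarith

/-- `c = 1` (Peskun order `𝓔 ≤ 𝓔'`): **`τ'^{(V)} ≤ τ^{(V)} + 1 − 1/V`** — per sweep, a positive
sampler that moves more is slower by less than one sweep, for every observable. -/
theorem thinned_tauInt_le_of_dirichlet_le_of_pos (hw0 : ∀ x, 0 ≤ w x)
    (hAi : ∀ ⦃f h : X → ℝ⦄, A f → A h → Integrable (fun x => f x * h x * w x) μ)
    (hAc : ∀ ⦃f h : X → ℝ⦄ (c : ℝ), A f → A h → A (fun x => f x + c * h x))
    (hAK : ∀ ⦃f : X → ℝ⦄, A f → A (K f))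
    (hlin : ∀ ⦃f h : X → ℝ⦄ (c : ℝ), A f → A h →
      ∀ x, K (fun s => f s + c * h s) x = K f x + c * K h x)
    (hsymm : ∀ ⦃f h : X → ℝ⦄, A f → A h →
      ∫ x, K f x * h x * w x ∂μ = ∫ x, f x * K h x * w x ∂μ)
    (hcontr : ∀ ⦃f : X → ℝ⦄, A f → ∫ x, K f x ^ 2 * w x ∂μ ≤ ∫ x, f x ^ 2 * w x ∂μ)
    (hAK' : ∀ ⦃f : X → ℝ⦄, A f → A (K' f))
    (hlin' : ∀ ⦃f h : X → ℝ⦄ (c : ℝ), A f → A h →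
      ∀ x, K' (fun s => f s + c * h s) x = K' f x + c * K' h x)
    (hsymm' : ∀ ⦃f h : X → ℝ⦄, A f → A h →
      ∫ x, K' f x * h x * w x ∂μ = ∫ x, f x * K' h x * w x ∂μ)
    (hcontr' : ∀ ⦃f : X → ℝ⦄, A f → ∫ x, K' f x ^ 2 * w x ∂μ ≤ ∫ x, f x ^ 2 * w x ∂μ)
    (hpos' : ∀ ⦃f : X → ℝ⦄, A f → 0 ≤ ∫ x, f x * K' f x * w x ∂μ)
    (hdom : ∀ ⦃v : X → ℝ⦄, A v →
      (∫ x, v x ^ 2 * w x ∂μ) - ∫ x, v x * K v x * w x ∂μ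
        ≤ (∫ x, v x ^ 2 * w x ∂μ) - ∫ x, v x * K' v x * w x ∂μ)
    {g : X → ℝ} (hg : A g) (hP : 0 < ∫ x, g x ^ 2 * w x ∂μ) {V : ℕ} (hV : 1 ≤ V)
    (hs : Summable fun n => (∫ x, g x * (K^[n + 1] g) x * w x ∂μ) / ∫ x, g x ^ 2 * w x ∂μ)
    (hsV : Summable fun n => (∫ x, g x * (K^[V * (n + 1)] g) x * w x ∂μ) / ∫ x, g x ^ 2 * w x ∂μ)
    (hs' : Summable fun n => (∫ x, g x * (K'^[n + 1] g) x * w x ∂μ) / ∫ x, g x ^ 2 * w x ∂μ) :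
    tauInt (fun n => (∫ x, g x * (K'^[V * n] g) x * w x ∂μ) / ∫ x, g x ^ 2 * w x ∂μ)
      ≤ tauInt (fun n => (∫ x, g x * (K^[V * n] g) x * w x ∂μ) / ∫ x, g x ^ 2 * w x ∂μ)
        + (1 - 1 / V) := by
  have h := thinned_tauInt_le_of_dirichlet_le_mul_of_pos hw0 hAi hAc hAK hlin hsymm hcontr hAK' hlin'
    hsymm' hcontr' hpos' one_pos (fun v hv => by simpa only [one_mul] using hdom hv) hg hP hV hs hsV hs'
  linarith

end RevOp

end Summit.Ventures.LatticeQCDFlow.Exactness
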